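import Literature.Analysis.Complex.RademacherPhragmenLindelof
import Literature.Analysis.SpecialFunctions.GammaStirlingOrder
import Literature.NumberTheory.LFunctions.ZetaFractionalPartIntegral
import Mathlib.NumberTheory.LSeries.Dirichlet
import Mathlib.NumberTheory.LSeries.HurwitzZetaValues
import Mathlib.Analysis.SpecialFunctions.Gamma.Beta
import HarnessLib

/-!
# Rankin–Selberg on `SL₂(ℤ)\ℍ`, III: polynomial growth of the continued Dirichlet series in the
strip `3/2 < Re w ≤ 5/2` (Phragmén–Lindelöf with a `Γ`-compensator)

Topic `NumberTheory/Automorphic`; namespace `Literature.NumberTheory.Automorphic`. Proof file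
(theorems only; no definition, no named fact), sequel to `RankinSelbergContinuationSL2` in the
weight `κ = 2` normalisation. The input is abstracted into an **entire function `J`** with

* `J(1 - s) = J(s)`;
* `J(s) = π^{-s} Γ(s) ζ(2s) · Γ(s+1) a^{-(s+1)} D(s+1) + (1/(2s) + 1/(2(1-s))) V` for `Re s > 1`,
  where `D(w) = Σ Cₙ n^{-w}` (`Cₙ ≥ 0`) converges absolutely for `Re w > 2`;
* `‖J(s)‖ ≤ M` on `-1/2 ≤ Re s ≤ 3/2`

(for a horocycle datum `G` with `κ = 2` these are `differentiable_J₀`, `J₀_one_sub`,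
`J₀_eq_of_one_lt_re`, `norm_J₀_le` of part II). Put `H(s) = s(s-1)J(s) + V/2` (`= s(s-1) ∫_𝒟 G E*`,
entire and symmetric) and `g(s) = H(s)/(Γ(s)Γ(s+1))` (entire: `1/Γ` is entire). We PROVE
(Rankin 1939, §4.4, Lemma 6 and Thm. 3 (iii): "`φ(s)` is regular … and of finite order"; the
device of dividing by the Gamma factors before applying Phragmén–Lindelöf is classical,
cf. Titchmarsh, *Zeta-function*, §5.1):

* `g_eq_of_one_lt_re` — `g(s) = s(s-1) π^{-s} ζ(2s) a^{-(s+1)} D(s+1)` on `Re s > 1`;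
* `norm_g_right_le`, `norm_g_left_le` — on `Re s = 3/2`, `‖g(s)‖ ≤ B ‖s+2‖³`; on `Re s = -1/2`,
  `‖g(s)‖ ≤ B (7/3)³ ‖s+2‖⁷` — by the functional equation and the EXACT Gamma ratio
  `‖Γ(1-s)Γ(2-s)‖ / ‖Γ(s)Γ(s+1)‖ = ‖s‖ ‖s+1‖² ‖s+2‖` on `Re s = -1/2` (`Γ(z+1) = zΓ(z)`,
  `Γ(z̄) = \overline{Γ(z)}`; no Stirling formula is needed);
* `exists_norm_g_le_exp_sq` — finite order inside the strip (`1/Γ(s) = s/Γ(s+1)` and the tree's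
  `norm_Gamma_ge_exp`: `‖Γ(x+iy)‖ ≥ (2/15)e^{-π|y|/2}` on `1/2 ≤ x ≤ 5/2`);
* `exists_norm_g_le_pow` — **`‖g(z)‖ ≤ K ‖z+2‖⁷` on `-1/2 ≤ Re z ≤ 3/2`** (Rademacher's explicit
  Phragmén–Lindelöf theorem `rademacher_phragmenLindelof_of_finiteOrder` of the tree);
* `norm_inv_riemannZeta_le` — `‖1/ζ(z)‖ ≤ Σ n^{-σ₀}` for `Re z ≥ σ₀ > 1` (Möbius inversion,
  Mathlib `LSeries_zeta_mul_Lseries_moebius`);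
* the **continued Dirichlet series** `𝒟(w) = g(w-1) aʷ π^{w-1} / ((w-1)(w-2) ζ(2w-2))`:
  `continuation_eq_LSeries` (`= D(w)` for `Re w > 2`), `differentiableOn_continuation`
  (holomorphic on `{Re w > 3/2} ∖ {2}`), `norm_continuation_le` (`≪ (1+|Im w|)⁵` on
  `3/2 + ε ≤ Re w ≤ 5/2`, `|Im w| ≥ 1`), `continuation_eq_div` and `continuation_residue`
  (**simple pole at `w = 2` with residue `3a²V/π`**, since `g(1) = V/2`, `ζ(2) = π²/6`) — exactly
  the input of the Perron step (part IV).

## References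

* R. A. Rankin, Proc. Cambridge Philos. Soc. 35 (1939), 357–372, §4.4, Lemma 6, Thm. 3.
* E. C. Titchmarsh, *The Theory of the Riemann Zeta-Function*, 2nd ed. (1986), §5.1.
* H. Rademacher, *Topics in Analytic Number Theory* (1973), Ch. 4.
-/

noncomputable section

open Complex Set Filter Real MeasureTheory
open scoped Topology ComplexConjugate

namespace Literature.NumberTheory.Automorphic

/-! ### Bounds for `ζ` on `Re z > 1` -/

section Zeta

/-- `‖ζ(z)‖ ≤ ‖z‖/(Re z - 1) + ‖z‖/Re z` for `Re z > 1` (the tree's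
`norm_riemannZeta_le_of_re_pos` and `‖z - 1‖ ≥ Re z - 1`). [folklore] -/
theorem norm_riemannZeta_le_of_one_lt_re {z : ℂ} (hz : 1 < z.re) :
    ‖riemannZeta z‖ ≤ ‖z‖ / (z.re - 1) + ‖z‖ / z.re := by
  have hz1 : z ≠ 1 := fun h ↦ by rw [h, Complex.one_re] at hz; exact lt_irrefl _ hz
  have h := Literature.NumberTheory.LFunctions.norm_riemannZeta_le_of_re_pos (by linarith) hz1
  have hre : z.re - 1 ≤ ‖z - 1‖ := by
    have := Complex.re_le_norm (z - 1)
    rwa [Complex.sub_re, Complex.one_re] at this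
  have h1 : ‖z‖ / ‖z - 1‖ ≤ ‖z‖ / (z.re - 1) :=
    div_le_div_of_nonneg_left (norm_nonneg _) (by linarith) hre
  linarith

/-- **`‖1/ζ(z)‖ ≤ Σₙ n^{-σ₀}` for `Re z ≥ σ₀ > 1`** (Möbius inversion `1/ζ = Σ μ(n) n^{-z}`,
Mathlib `LSeries_zeta_mul_Lseries_moebius`, and `|μ(n)| ≤ 1`). [folklore] -/
theorem norm_inv_riemannZeta_le {σ₀ : ℝ} (hσ₀ : 1 < σ₀) {z : ℂ} (hz : σ₀ ≤ z.re) :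
    ‖(riemannZeta z)⁻¹‖ ≤ ∑' n : ℕ, (n : ℝ) ^ (-σ₀) := by
  have hz1 : 1 < z.re := hσ₀.trans_le hz
  have hmul := LSeries_one_mul_Lseries_moebius hz1
  rw [LSeries_one_eq_riemannZeta hz1] at hmul
  have hζ : riemannZeta z ≠ 0 := riemannZeta_ne_zero_of_one_lt_re hz1
  have hinv : (riemannZeta z)⁻¹ = LSeries (fun n ↦ (ArithmeticFunction.moebius n : ℂ)) z := by
    have := congrArg (fun x ↦ (riemannZeta z)⁻¹ * x) hmul
    simp only [← mul_assoc, inv_mul_cancel₀ hζ, one_mul, mul_one] at this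
    exact this.symm
  rw [hinv]
  have hsum : LSeriesSummable (fun n ↦ (ArithmeticFunction.moebius n : ℂ)) z :=
    ArithmeticFunction.LSeriesSummable_moebius_iff.mpr hz1
  have hsn := hsum.norm
  have hS : Summable fun n : ℕ ↦ (n : ℝ) ^ (-σ₀) :=
    Real.summable_nat_rpow.mpr (by linarith)
  refine (norm_tsum_le_tsum_norm hsn).trans (Summable.tsum_le_tsum (fun n ↦ ?_) hsn hS)
  rcases Nat.eq_zero_or_pos n with rfl | hn
  · simp [LSeries.term_zero, Real.zero_rpow (by linarith : -σ₀ ≠ 0)]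
  · rw [LSeries.norm_term_eq, if_neg hn.ne']
    have hμ : ‖(ArithmeticFunction.moebius n : ℂ)‖ ≤ 1 := by
      rw [Complex.norm_intCast]
      exact_mod_cast ArithmeticFunction.abs_moebius_le_one
    have hn1 : (1 : ℝ) ≤ n := by exact_mod_cast hn
    calc ‖(ArithmeticFunction.moebius n : ℂ)‖ / (n : ℝ) ^ z.re ≤ 1 / (n : ℝ) ^ z.re :=
          div_le_div_of_nonneg_right hμ (by positivity)
      _ = (n : ℝ) ^ (-z.re) := by rw [Real.rpow_neg (by positivity), one_div]
      _ ≤ (n : ℝ) ^ (-σ₀) := Real.rpow_le_rpow_of_exponent_le hn1 (by linarith)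

end Zeta

/-! ### Gamma factors on the lines `Re s = -1/2, 1/2, 3/2, 5/2` -/

section Gamma

/-- `‖Γ(z̄)‖ = ‖Γ(z)‖`. [folklore] -/
theorem norm_Gamma_conj (z : ℂ) : ‖Complex.Gamma (conj z)‖ = ‖Complex.Gamma z‖ := by
  rw [Complex.Gamma_conj, Complex.norm_conj]

/-- **The exact Gamma ratio on `Re s = -1/2`**: with `s = -1/2 + it`,
`‖Γ(1-s)‖ ‖Γ(2-s)‖ = ‖s‖ ‖s+1‖² ‖s+2‖ · (‖Γ(s)‖ ‖Γ(s+1)‖)` and `‖Γ(s)‖ ‖Γ(s+1)‖ ≠ 0` —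
from `Γ(z+1) = zΓ(z)` and `‖Γ(1/2 - it)‖ = ‖Γ(1/2 + it)‖`. [folklore] -/
theorem norm_Gamma_ratio_left_line (t : ℝ) :
    ‖Complex.Gamma (1 - (-1 / 2 + t * I))‖ * ‖Complex.Gamma (2 - (-1 / 2 + t * I))‖ =
        ‖(-1 / 2 + t * I : ℂ)‖ * ‖(-1 / 2 + t * I : ℂ) + 1‖ ^ 2 * ‖(-1 / 2 + t * I : ℂ) + 2‖ *
          (‖Complex.Gamma (-1 / 2 + t * I)‖ * ‖Complex.Gamma (-1 / 2 + t * I + 1)‖) ∧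
      ‖Complex.Gamma (-1 / 2 + t * I)‖ * ‖Complex.Gamma (-1 / 2 + t * I + 1)‖ ≠ 0 := by
  set u : ℂ := 1 / 2 + t * I with hu
  have hure : u.re = 1 / 2 := by simp [hu]
  have hu0 : u ≠ 0 := fun h ↦ by have := congrArg Complex.re h; rw [hure] at this; norm_num at this
  have hcu0 : conj u ≠ 0 := fun h ↦ hu0 (by simpa using congrArg conj h)
  have hcu1 : conj u + 1 ≠ 0 := fun h ↦ by
    have := congrArg Complex.re h
    simp [hu] at this; norm_num at this
  have hu1 : u - 1 ≠ 0 := fun h ↦ by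
    have := congrArg Complex.re h
    rw [Complex.sub_re, hure] at this; norm_num at this
  have hΓu : Complex.Gamma u ≠ 0 := Complex.Gamma_ne_zero_of_re_pos (by rw [hure]; norm_num)
  -- express everything through `u`
  have e1 : (1 : ℂ) - (-1 / 2 + t * I) = conj u + 1 := by
    apply Complex.ext
    · simp [hu]; norm_num
    · simp [hu]
  have e2 : (2 : ℂ) - (-1 / 2 + t * I) = conj u + 1 + 1 := by
    apply Complex.ext
    · simp [hu]; norm_num
    · simp [hu]
  have e3 : (-1 / 2 + t * I : ℂ) + 1 = u := by rw [hu]; ring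
  have e4 : (-1 / 2 + t * I : ℂ) = u - 1 := by rw [hu]; ring
  have hG1 : Complex.Gamma (conj u + 1) = conj u * Complex.Gamma (conj u) := Complex.Gamma_add_one _ hcu0
  have hG2 : Complex.Gamma (conj u + 1 + 1) = (conj u + 1) * (conj u * Complex.Gamma (conj u)) := by
    rw [Complex.Gamma_add_one _ hcu1, hG1]
  have hG3 : Complex.Gamma u = (u - 1) * Complex.Gamma (u - 1) := by
    have := Complex.Gamma_add_one (u - 1) hu1
    rwa [sub_add_cancel] at this
  have hγ : ‖Complex.Gamma (conj u)‖ = ‖Complex.Gamma u‖ := norm_Gamma_conj u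
  have hΓum1 : ‖Complex.Gamma (u - 1)‖ = ‖Complex.Gamma u‖ / ‖u - 1‖ := by
    rw [hG3, norm_mul, mul_div_cancel_left₀ _ (norm_ne_zero_iff.mpr hu1)]
  have hnc : ‖conj u + 1‖ = ‖u + 1‖ := by
    have h := Complex.norm_conj (u + 1)
    rw [map_add, map_one] at h
    exact h
  rw [e1, e2, e3, e4, hG1, hG2, norm_mul, norm_mul, norm_mul, hγ, hΓum1, hnc,
    show u - 1 + 2 = u + 1 by ring, Complex.norm_conj]
  have hn0 : ‖Complex.Gamma u‖ ≠ 0 := norm_ne_zero_iff.mpr hΓu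
  have hn1 : ‖u - 1‖ ≠ 0 := norm_ne_zero_iff.mpr hu1
  refine ⟨?_, ?_⟩
  · field_simp
  · exact mul_ne_zero (div_ne_zero hn0 hn1) hn0

/-- `‖2 + (1 - s)‖ ≤ (7/3) ‖s + 2‖` on `Re s = -1/2` (`‖7/2 - it‖ ≤ (7/3) ‖3/2 + it‖`). [folklore] -/
theorem norm_two_add_one_sub_le (t : ℝ) :
    ‖(2 : ℂ) + (1 - (-1 / 2 + t * I))‖ ≤ 7 / 3 * ‖(-1 / 2 + t * I : ℂ) + 2‖ := by
  have e1 : (2 : ℂ) + (1 - (-1 / 2 + t * I)) = ((7 / 2 : ℝ) : ℂ) + ((-t : ℝ) : ℂ) * I := by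
    push_cast; ring
  have e2 : (-1 / 2 + t * I : ℂ) + 2 = ((3 / 2 : ℝ) : ℂ) + (t : ℂ) * I := by push_cast; ring
  rw [e1, e2, Complex.norm_add_mul_I, Complex.norm_add_mul_I]
  rw [show (7 / 3 : ℝ) * Real.sqrt ((3 / 2) ^ 2 + t ^ 2) = Real.sqrt ((7 / 3) ^ 2 * ((3 / 2) ^ 2 + t ^ 2)) by
    rw [Real.sqrt_mul (by positivity), Real.sqrt_sq (by positivity)]]
  exact Real.sqrt_le_sqrt (by nlinarith [sq_nonneg t])

end Gamma

/-! ### The entire function `g(s) = (s(s-1)J(s) + V/2)/(Γ(s)Γ(s+1))` -/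

section G

variable {C : ℕ → ℝ} {a : ℝ} {V : ℂ} {J : ℂ → ℂ}

/-- `g` is entire (`1/Γ` is entire). [folklore] -/
theorem differentiable_g (hJ : Differentiable ℂ J) :
    Differentiable ℂ fun s : ℂ ↦ (s * (s - 1) * J s + V / 2) * (Complex.Gamma s)⁻¹ *
      (Complex.Gamma (s + 1))⁻¹ := by
  refine Differentiable.mul (Differentiable.mul ?_ Complex.differentiable_one_div_Gamma)
    (Complex.differentiable_one_div_Gamma.comp (differentiable_id.add_const 1))
  exact (((differentiable_id.mul (differentiable_id.sub_const 1)).mul hJ).add_const _)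

/-- `H(1 - s) = H(s)` for `H(s) = s(s-1)J(s) + V/2`. [folklore] -/
theorem H_one_sub (hJfe : ∀ s, J (1 - s) = J s) (s : ℂ) :
    (1 - s) * ((1 - s) - 1) * J (1 - s) + V / 2 = s * (s - 1) * J s + V / 2 := by
  rw [hJfe]; ring

/-- **`g` on the half-plane of convergence**: for `Re s > 1`,
`g(s) = s(s-1) π^{-s} ζ(2s) a^{-(s+1)} D(s+1)` — the pole terms of `J` cancel against `V/2`.
[folklore] -/
theorem g_eq_of_one_lt_re
    (hJeq : ∀ s : ℂ, 1 < s.re → J s = (π : ℂ) ^ (-s) * Complex.Gamma s * riemannZeta (2 * s) *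
      (Complex.Gamma (s + 1) * (a : ℂ) ^ (-(s + 1)) * LSeries (fun n ↦ (C n : ℂ)) (s + 1)) +
        (1 / (2 * s) + 1 / (2 * (1 - s))) * V)
    {s : ℂ} (hs : 1 < s.re) :
    (s * (s - 1) * J s + V / 2) * (Complex.Gamma s)⁻¹ * (Complex.Gamma (s + 1))⁻¹ =
      s * (s - 1) * (π : ℂ) ^ (-s) * riemannZeta (2 * s) * (a : ℂ) ^ (-(s + 1)) *
        LSeries (fun n ↦ (C n : ℂ)) (s + 1) := by
  have hs0 : s ≠ 0 := fun h ↦ by rw [h, Complex.zero_re] at hs; linarith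
  have hs1 : (1 : ℂ) - s ≠ 0 := fun h ↦ by
    have := congrArg Complex.re h; rw [Complex.sub_re, Complex.one_re, Complex.zero_re] at this; linarith
  have hΓ0 : Complex.Gamma s ≠ 0 := Complex.Gamma_ne_zero_of_re_pos (by linarith)
  have hΓ1 : Complex.Gamma (s + 1) ≠ 0 := Complex.Gamma_ne_zero_of_re_pos (by simp; linarith)
  rw [hJeq s hs]
  field_simp
  ring

/-- **Right boundary**: on `Re s = 3/2`, `‖g(s)‖ ≤ 2 π^{-3/2} a^{-5/2} D₀ ‖s + 2‖³` with
`D₀ = Σ Cₙ n^{-5/2}` (`‖ζ(2s)‖ ≤ 2‖s+2‖`, `‖s‖, ‖s-1‖ ≤ ‖s+2‖`, `‖D(s+1)‖ ≤ D₀`). [folklore] -/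
theorem norm_g_right_le (hC : ∀ n, 0 ≤ C n) (ha : 0 < a)
    (hCs : Summable fun n : ℕ ↦ C n / (n : ℝ) ^ (5 / 2 : ℝ))
    (hJeq : ∀ s : ℂ, 1 < s.re → J s = (π : ℂ) ^ (-s) * Complex.Gamma s * riemannZeta (2 * s) *
      (Complex.Gamma (s + 1) * (a : ℂ) ^ (-(s + 1)) * LSeries (fun n ↦ (C n : ℂ)) (s + 1)) +
        (1 / (2 * s) + 1 / (2 * (1 - s))) * V)
    (t : ℝ) :
    ‖((3 / 2 + t * I : ℂ) * ((3 / 2 + t * I) - 1) * J (3 / 2 + t * I) + V / 2) *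
        (Complex.Gamma (3 / 2 + t * I))⁻¹ * (Complex.Gamma ((3 / 2 + t * I) + 1))⁻¹‖ ≤
      (2 * π ^ (-(3 / 2 : ℝ)) * a ^ (-(5 / 2 : ℝ)) * ∑' n : ℕ, C n / (n : ℝ) ^ (5 / 2 : ℝ)) *
        ‖(-1 / 2 + t * I : ℂ) + 2 + 2‖ ^ 3 := by
  set s : ℂ := 3 / 2 + t * I with hs
  have hsre : s.re = 3 / 2 := by simp [hs]
  have hsim : s.im = t := by simp [hs]
  have h1 : 1 < s.re := by rw [hsre]; norm_num
  rw [g_eq_of_one_lt_re hJeq h1]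
  have e2 : (-1 / 2 + t * I : ℂ) + 2 + 2 = s + 2 := by rw [hs]; ring
  rw [e2]
  -- the pieces
  have hns : ‖s‖ ≤ ‖s + 2‖ := by
    rw [show s = ((3 / 2 : ℝ) : ℂ) + t * I by rw [hs]; push_cast; ring,
      show ((3 / 2 : ℝ) : ℂ) + t * I + 2 = ((7 / 2 : ℝ) : ℂ) + t * I by push_cast; ring,
      Complex.norm_add_mul_I, Complex.norm_add_mul_I]
    exact Real.sqrt_le_sqrt (by nlinarith)
  have hns1 : ‖s - 1‖ ≤ ‖s + 2‖ := by
    rw [show s - 1 = ((1 / 2 : ℝ) : ℂ) + t * I by rw [hs]; push_cast; ring,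
      show s + 2 = ((7 / 2 : ℝ) : ℂ) + t * I by rw [hs]; push_cast; ring,
      Complex.norm_add_mul_I, Complex.norm_add_mul_I]
    exact Real.sqrt_le_sqrt (by nlinarith)
  have hπ : ‖(π : ℂ) ^ (-s)‖ = π ^ (-(3 / 2 : ℝ)) := by
    rw [Complex.norm_cpow_eq_rpow_re_of_pos Real.pi_pos, Complex.neg_re, hsre]
  have haa : ‖(a : ℂ) ^ (-(s + 1))‖ = a ^ (-(5 / 2 : ℝ)) := by
    rw [Complex.norm_cpow_eq_rpow_re_of_pos ha, Complex.neg_re, Complex.add_re, hsre, Complex.one_re]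
    norm_num
  have hζ : ‖riemannZeta (2 * s)‖ ≤ 2 * ‖s + 2‖ := by
    have h2re : (2 * s).re = 3 := by simp [hsre]; norm_num
    have h := norm_riemannZeta_le_of_one_lt_re (z := 2 * s) (by rw [h2re]; norm_num)
    rw [h2re, norm_mul, Complex.norm_two] at h
    have : ‖s‖ ≤ ‖s + 2‖ := hns
    nlinarith [norm_nonneg s]
  have hD : ‖LSeries (fun n ↦ (C n : ℂ)) (s + 1)‖ ≤ ∑' n : ℕ, C n / (n : ℝ) ^ (5 / 2 : ℝ) := by
    have hre : (s + 1).re = 5 / 2 := by rw [Complex.add_re, hsre, Complex.one_re]; norm_num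
    have hterm : ∀ n : ℕ, ‖LSeries.term (fun n ↦ (C n : ℂ)) (s + 1) n‖ = C n / (n : ℝ) ^ (5 / 2 : ℝ) := by
      intro n
      rcases Nat.eq_zero_or_pos n with rfl | hn
      · simp [LSeries.term_zero, Real.zero_rpow (by norm_num : (5 / 2 : ℝ) ≠ 0)]
      · rw [LSeries.norm_term_eq, if_neg hn.ne', hre, Complex.norm_real, Real.norm_of_nonneg (hC n)]
    have hsn : Summable fun n ↦ ‖LSeries.term (fun n ↦ (C n : ℂ)) (s + 1) n‖ := by
      simp_rw [hterm]; exact hCs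
    calc ‖LSeries (fun n ↦ (C n : ℂ)) (s + 1)‖ ≤ ∑' n, ‖LSeries.term (fun n ↦ (C n : ℂ)) (s + 1) n‖ :=
          norm_tsum_le_tsum_norm hsn
      _ = ∑' n : ℕ, C n / (n : ℝ) ^ (5 / 2 : ℝ) := by simp_rw [hterm]
  have hD0 : 0 ≤ ∑' n : ℕ, C n / (n : ℝ) ^ (5 / 2 : ℝ) := tsum_nonneg fun n ↦ by
    have := hC n; positivity
  rw [norm_mul, norm_mul, norm_mul, norm_mul, norm_mul, hπ, haa]
  have hP : 0 ≤ ‖s + 2‖ := norm_nonneg _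
  calc ‖s‖ * ‖s - 1‖ * π ^ (-(3 / 2 : ℝ)) * ‖riemannZeta (2 * s)‖ * a ^ (-(5 / 2 : ℝ)) *
        ‖LSeries (fun n ↦ (C n : ℂ)) (s + 1)‖
      ≤ ‖s + 2‖ * ‖s + 2‖ * π ^ (-(3 / 2 : ℝ)) * (2 * ‖s + 2‖) * a ^ (-(5 / 2 : ℝ)) *
          (∑' n : ℕ, C n / (n : ℝ) ^ (5 / 2 : ℝ)) := by
        gcongr
    _ = (2 * π ^ (-(3 / 2 : ℝ)) * a ^ (-(5 / 2 : ℝ)) * ∑' n : ℕ, C n / (n : ℝ) ^ (5 / 2 : ℝ)) *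
          ‖s + 2‖ ^ 3 := by ring

/-- **Left boundary**: on `Re s = -1/2`, `‖g(s)‖ ≤ B (7/3)³ ‖s + 2‖⁷` whenever
`‖g‖ ≤ B ‖· + 2‖³` on `Re s = 3/2` — functional equation `H(1-s) = H(s)` and the exact Gamma
ratio `norm_Gamma_ratio_left_line`. [folklore] -/
theorem norm_g_left_le (hJfe : ∀ s, J (1 - s) = J s) {B : ℝ} (hB : 0 ≤ B)
    (hright : ∀ t : ℝ,
      ‖((3 / 2 + t * I : ℂ) * ((3 / 2 + t * I) - 1) * J (3 / 2 + t * I) + V / 2) *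
          (Complex.Gamma (3 / 2 + t * I))⁻¹ * (Complex.Gamma ((3 / 2 + t * I) + 1))⁻¹‖ ≤
        B * ‖(-1 / 2 + t * I : ℂ) + 2 + 2‖ ^ 3)
    (t : ℝ) :
    ‖((-1 / 2 + t * I : ℂ) * ((-1 / 2 + t * I) - 1) * J (-1 / 2 + t * I) + V / 2) *
        (Complex.Gamma (-1 / 2 + t * I))⁻¹ * (Complex.Gamma ((-1 / 2 + t * I) + 1))⁻¹‖ ≤
      (B * (7 / 3) ^ 3) * ‖(-1 / 2 + t * I : ℂ) + 2‖ ^ 7 := by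
  obtain ⟨hratio, hne⟩ := norm_Gamma_ratio_left_line t
  set s : ℂ := -1 / 2 + t * I with hs
  have hΓ1s : Complex.Gamma (1 - s) ≠ 0 := Complex.Gamma_ne_zero_of_re_pos (by simp [hs]; norm_num)
  have hΓ2s : Complex.Gamma (2 - s) ≠ 0 := Complex.Gamma_ne_zero_of_re_pos (by simp [hs]; norm_num)
  -- `H(s) = H(1-s) = g(1-s) Γ(1-s) Γ(2-s)`
  have hH : s * (s - 1) * J s + V / 2 =
      (((1 - s) * ((1 - s) - 1) * J (1 - s) + V / 2) * (Complex.Gamma (1 - s))⁻¹ *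
        (Complex.Gamma ((1 - s) + 1))⁻¹) * (Complex.Gamma (1 - s) * Complex.Gamma (2 - s)) := by
    rw [H_one_sub hJfe, show (1 : ℂ) - s + 1 = 2 - s by ring]
    field_simp
  -- the right-line bound at `1 - s = 3/2 - it`
  have h1s : (1 : ℂ) - s = 3 / 2 + ((-t : ℝ) : ℂ) * I := by rw [hs]; push_cast; ring
  have hg1s : ‖((1 - s) * ((1 - s) - 1) * J (1 - s) + V / 2) * (Complex.Gamma (1 - s))⁻¹ *
      (Complex.Gamma ((1 - s) + 1))⁻¹‖ ≤ B * ‖(2 : ℂ) + (1 - s)‖ ^ 3 := by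
    have h := hright (-t)
    rw [← h1s] at h
    have e : (-1 / 2 + ((-t : ℝ) : ℂ) * I : ℂ) + 2 + 2 = 2 + (1 - s) := by rw [hs]; push_cast; ring
    rwa [e] at h
  have h73 := norm_two_add_one_sub_le t
  have hs2 : ‖s‖ ≤ ‖s + 2‖ := by
    rw [show s = ((-1 / 2 : ℝ) : ℂ) + t * I by rw [hs]; push_cast; ring,
      show ((-1 / 2 : ℝ) : ℂ) + t * I + 2 = ((3 / 2 : ℝ) : ℂ) + t * I by push_cast; ring,
      Complex.norm_add_mul_I, Complex.norm_add_mul_I]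
    exact Real.sqrt_le_sqrt (by nlinarith)
  have hs1 : ‖s + 1‖ ≤ ‖s + 2‖ := by
    rw [show s + 1 = ((1 / 2 : ℝ) : ℂ) + t * I by rw [hs]; push_cast; ring,
      show s + 2 = ((3 / 2 : ℝ) : ℂ) + t * I by rw [hs]; push_cast; ring,
      Complex.norm_add_mul_I, Complex.norm_add_mul_I]
    exact Real.sqrt_le_sqrt (by nlinarith)
  -- the norm identity `‖g(s)‖ = ‖g(1-s)‖ ‖s‖ ‖s+1‖² ‖s+2‖`
  have hG0 : 0 < ‖Complex.Gamma s‖ * ‖Complex.Gamma (s + 1)‖ :=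
    lt_of_le_of_ne (mul_nonneg (norm_nonneg _) (norm_nonneg _)) (Ne.symm hne)
  have hΓs : ‖Complex.Gamma s‖ ≠ 0 := fun h ↦ by rw [h, zero_mul] at hne; exact hne rfl
  have hΓs1 : ‖Complex.Gamma (s + 1)‖ ≠ 0 := fun h ↦ by rw [h, mul_zero] at hne; exact hne rfl
  have key : ‖(s * (s - 1) * J s + V / 2) * (Complex.Gamma s)⁻¹ * (Complex.Gamma (s + 1))⁻¹‖ =
      ‖((1 - s) * ((1 - s) - 1) * J (1 - s) + V / 2) * (Complex.Gamma (1 - s))⁻¹ *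
        (Complex.Gamma ((1 - s) + 1))⁻¹‖ * (‖s‖ * ‖s + 1‖ ^ 2 * ‖s + 2‖) := by
    rw [hH, norm_mul, norm_mul, norm_mul, norm_mul (Complex.Gamma (1 - s)), norm_inv, norm_inv, hratio]
    field_simp
  rw [key]
  calc ‖((1 - s) * ((1 - s) - 1) * J (1 - s) + V / 2) * (Complex.Gamma (1 - s))⁻¹ *
          (Complex.Gamma ((1 - s) + 1))⁻¹‖ * (‖s‖ * ‖s + 1‖ ^ 2 * ‖s + 2‖)
      ≤ (B * ‖(2 : ℂ) + (1 - s)‖ ^ 3) * (‖s + 2‖ * ‖s + 2‖ ^ 2 * ‖s + 2‖) := by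
        gcongr
    _ ≤ (B * ((7 / 3) * ‖s + 2‖) ^ 3) * (‖s + 2‖ * ‖s + 2‖ ^ 2 * ‖s + 2‖) := by
        gcongr
    _ = (B * (7 / 3) ^ 3) * ‖s + 2‖ ^ 7 := by ring

/-- **Finite order inside the strip**: on `-1/2 < Re s < 3/2`,
`‖g(s)‖ ≤ C_g e^{|Im s|²}` — from `1/Γ(s) = s/Γ(s+1)`, the tree's lower bound
`‖Γ(x+iy)‖ ≥ (2/15) e^{-π|y|/2}` (`1/2 ≤ x ≤ 5/2`) and `‖J‖ ≤ M`. [folklore] -/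
theorem exists_norm_g_le_exp_sq
    (hJbd : ∃ M : ℝ, ∀ s : ℂ, -1 / 2 ≤ s.re → s.re ≤ 3 / 2 → ‖J s‖ ≤ M) :
    ∃ Cg : ℝ, ∀ s : ℂ, -1 / 2 < s.re → s.re < 3 / 2 →
      ‖(s * (s - 1) * J s + V / 2) * (Complex.Gamma s)⁻¹ * (Complex.Gamma (s + 1))⁻¹‖ ≤
        Cg * Real.exp (|s.im| ^ (2 : ℝ)) := by
  obtain ⟨M, hM⟩ := hJbd
  have hM0 : 0 ≤ max M 0 := le_max_right _ _
  refine ⟨(8 * max M 0 + ‖V‖) * (225 / 4) * Real.exp (49 / 4), fun s hs1 hs2 ↦ ?_⟩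
  set t : ℝ := s.im with ht
  -- the two Gamma reciprocals
  have hΓ1 : ‖(Complex.Gamma (s + 1))⁻¹‖ ≤ 15 / 2 * Real.exp (π * |t| / 2) := by
    have h := Literature.Analysis.SpecialFunctions.norm_Gamma_ge_exp (x := s.re + 1) (by linarith) (by linarith) t
    have e : ((s.re + 1 : ℝ) : ℂ) + t * I = s + 1 := by
      rw [ht]; apply Complex.ext <;> simp
    rw [e] at h
    have hpos : 0 < 2 / 15 * Real.exp (-(π * |t|) / 2) := by positivity
    rw [norm_inv]
    calc ‖Complex.Gamma (s + 1)‖⁻¹ ≤ (2 / 15 * Real.exp (-(π * |t|) / 2))⁻¹ := inv_anti₀ hpos h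
      _ = 15 / 2 * Real.exp (π * |t| / 2) := by
          rw [neg_div, Real.exp_neg, mul_inv, inv_inv]; norm_num
  have hΓ0 : ‖(Complex.Gamma s)⁻¹‖ ≤ ‖s‖ * (15 / 2 * Real.exp (π * |t| / 2)) := by
    by_cases h0 : s = 0
    · rw [h0, Complex.Gamma_zero, inv_zero, norm_zero]; positivity
    · have hrec := Complex.Gamma_add_one s h0
      have hΓs1 : Complex.Gamma (s + 1) ≠ 0 := Complex.Gamma_ne_zero_of_re_pos (by simp; linarith)
      have e : (Complex.Gamma s)⁻¹ = s * (Complex.Gamma (s + 1))⁻¹ := by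
        rw [hrec, mul_inv, ← mul_assoc, mul_inv_cancel₀ h0, one_mul]
      rw [e, norm_mul]
      exact mul_le_mul_of_nonneg_left hΓ1 (norm_nonneg _)
  -- sizes of `s`, `s - 1`
  have habs : |s.re| ≤ 3 / 2 := abs_le.mpr ⟨by linarith, by linarith⟩
  have hns : ‖s‖ ≤ 2 + |t| := by
    calc ‖s‖ ≤ |s.re| + |s.im| := Complex.norm_le_abs_re_add_abs_im s
      _ ≤ 2 + |t| := by rw [ht]; linarith
  have hns1 : ‖s - 1‖ ≤ 2 + |t| := by
    have habs1 : |(s - 1).re| ≤ 3 / 2 := by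
      rw [Complex.sub_re, Complex.one_re]; exact abs_le.mpr ⟨by linarith, by linarith⟩
    calc ‖s - 1‖ ≤ |(s - 1).re| + |(s - 1).im| := Complex.norm_le_abs_re_add_abs_im _
      _ ≤ 2 + |t| := by rw [Complex.sub_im, Complex.one_im, sub_zero, ht]; linarith
  have hJs : ‖J s‖ ≤ max M 0 := (hM s hs1.le hs2.le).trans (le_max_left _ _)
  -- `2 + |t| ≤ 2 e^{|t|}` and `e^{7|t|} ≤ e^{49/4} e^{t²}`
  have h2t : 2 + |t| ≤ 2 * Real.exp |t| := by
    have := Real.add_one_le_exp |t|; have := abs_nonneg t; linarith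
  have hE0 : 0 < Real.exp |t| := Real.exp_pos _
  have h7 : Real.exp (7 * |t|) ≤ Real.exp (49 / 4) * Real.exp (|t| ^ (2 : ℝ)) := by
    rw [← Real.exp_add, Real.rpow_two]
    exact Real.exp_le_exp.mpr (by nlinarith [sq_nonneg (|t| - 7 / 2)])
  have hπ4 : π * |t| / 2 + π * |t| / 2 ≤ 4 * |t| := by
    have := Real.pi_lt_four; have := abs_nonneg t; nlinarith
  -- assemble
  have hH : ‖s * (s - 1) * J s + V / 2‖ ≤ (2 + |t|) * (2 + |t|) * max M 0 + ‖V‖ / 2 := by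
    calc ‖s * (s - 1) * J s + V / 2‖ ≤ ‖s * (s - 1) * J s‖ + ‖V / 2‖ := norm_add_le _ _
      _ = ‖s‖ * ‖s - 1‖ * ‖J s‖ + ‖V‖ / 2 := by
          rw [norm_mul, norm_mul, norm_div, Complex.norm_two]
      _ ≤ (2 + |t|) * (2 + |t|) * max M 0 + ‖V‖ / 2 := by gcongr
  calc ‖(s * (s - 1) * J s + V / 2) * (Complex.Gamma s)⁻¹ * (Complex.Gamma (s + 1))⁻¹‖
      = ‖s * (s - 1) * J s + V / 2‖ * ‖(Complex.Gamma s)⁻¹‖ * ‖(Complex.Gamma (s + 1))⁻¹‖ := by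
        rw [norm_mul, norm_mul]
    _ ≤ ((2 + |t|) * (2 + |t|) * max M 0 + ‖V‖ / 2) * (‖s‖ * (15 / 2 * Real.exp (π * |t| / 2))) *
          (15 / 2 * Real.exp (π * |t| / 2)) := by gcongr
    _ ≤ ((2 + |t|) * (2 + |t|) * max M 0 + ‖V‖ / 2) * ((2 + |t|) * (15 / 2 * Real.exp (π * |t| / 2))) *
          (15 / 2 * Real.exp (π * |t| / 2)) := by gcongr
    _ = ((2 + |t|) * (2 + |t|) * max M 0 + ‖V‖ / 2) * (2 + |t|) * (225 / 4) *
          Real.exp (π * |t| / 2 + π * |t| / 2) := by rw [Real.exp_add]; ring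
    _ ≤ ((2 * Real.exp |t|) * (2 * Real.exp |t|) * max M 0 + ‖V‖ / 2 * (Real.exp |t| * Real.exp |t|)) *
          (2 * Real.exp |t|) * (225 / 4) * Real.exp (4 * |t|) := by
        have hV2 : ‖V‖ / 2 ≤ ‖V‖ / 2 * (Real.exp |t| * Real.exp |t|) := by
          have h1 : (1 : ℝ) ≤ Real.exp |t| * Real.exp |t| := by
            have := Real.one_le_exp (abs_nonneg t); nlinarith
          have := norm_nonneg V
          nlinarith
        gcongr
    _ = (8 * max M 0 + ‖V‖) * (225 / 4) * Real.exp (7 * |t|) := by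
        have e3 : Real.exp |t| * Real.exp |t| * Real.exp |t| * Real.exp (4 * |t|) = Real.exp (7 * |t|) := by
          rw [← Real.exp_add, ← Real.exp_add, ← Real.exp_add]; ring_nf
        rw [← e3]; ring
    _ ≤ (8 * max M 0 + ‖V‖) * (225 / 4) * (Real.exp (49 / 4) * Real.exp (|t| ^ (2 : ℝ))) := by
        gcongr
    _ = (8 * max M 0 + ‖V‖) * (225 / 4) * Real.exp (49 / 4) * Real.exp (|s.im| ^ (2 : ℝ)) := by
        rw [ht]; ring

/-- `X^θ Y^{1-θ} ≤ Z` if `0 ≤ X, Y ≤ Z` and `0 ≤ θ ≤ 1`. [folklore] -/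
theorem rpow_mul_rpow_le_of_le {X Y Z θ : ℝ} (hX : 0 ≤ X) (hY : 0 ≤ Y) (hXZ : X ≤ Z) (hYZ : Y ≤ Z)
    (hθ0 : 0 ≤ θ) (hθ1 : θ ≤ 1) : X ^ θ * Y ^ (1 - θ) ≤ Z := by
  have hZ : 0 ≤ Z := hX.trans hXZ
  calc X ^ θ * Y ^ (1 - θ) ≤ Z ^ θ * Z ^ (1 - θ) :=
        mul_le_mul (Real.rpow_le_rpow hX hXZ hθ0) (Real.rpow_le_rpow hY hYZ (by linarith))
          (Real.rpow_nonneg hY _) (Real.rpow_nonneg hZ _)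
    _ = Z := by
        rcases eq_or_lt_of_le hZ with h | h
        · rw [← h]
          rcases eq_or_lt_of_le hθ0 with h0 | h0
          · rw [← h0]; simp
          · rw [Real.zero_rpow h0.ne']; simp
        · rw [← Real.rpow_add h]; simp

/-- **Phragmén–Lindelöf: `‖g(z)‖ ≤ K ‖z + 2‖⁷` on `-1/2 ≤ Re z ≤ 3/2`** (Rademacher's explicit
theorem `rademacher_phragmenLindelof_of_finiteOrder` with `Q = 2`, `α = 7`, `β = 3` and the
three bounds above; Rankin 1939, §4.4, Lemma 6). [cite: Rankin1939, §4] -/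
theorem exists_norm_g_le_pow (hC : ∀ n, 0 ≤ C n) (ha : 0 < a)
    (hCs : Summable fun n : ℕ ↦ C n / (n : ℝ) ^ (5 / 2 : ℝ))
    (hJ : Differentiable ℂ J) (hJfe : ∀ s, J (1 - s) = J s)
    (hJeq : ∀ s : ℂ, 1 < s.re → J s = (π : ℂ) ^ (-s) * Complex.Gamma s * riemannZeta (2 * s) *
      (Complex.Gamma (s + 1) * (a : ℂ) ^ (-(s + 1)) * LSeries (fun n ↦ (C n : ℂ)) (s + 1)) +
        (1 / (2 * s) + 1 / (2 * (1 - s))) * V)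
    (hJbd : ∃ M : ℝ, ∀ s : ℂ, -1 / 2 ≤ s.re → s.re ≤ 3 / 2 → ‖J s‖ ≤ M) :
    ∃ K : ℝ, 0 ≤ K ∧ ∀ z : ℂ, -1 / 2 ≤ z.re → z.re ≤ 3 / 2 →
      ‖(z * (z - 1) * J z + V / 2) * (Complex.Gamma z)⁻¹ * (Complex.Gamma (z + 1))⁻¹‖ ≤
        K * ‖z + 2‖ ^ 7 := by
  set g : ℂ → ℂ := fun z ↦ (z * (z - 1) * J z + V / 2) * (Complex.Gamma z)⁻¹ * (Complex.Gamma (z + 1))⁻¹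
    with hgdef
  set B₀ : ℝ := 2 * π ^ (-(3 / 2 : ℝ)) * a ^ (-(5 / 2 : ℝ)) * ∑' n : ℕ, C n / (n : ℝ) ^ (5 / 2 : ℝ) with hB₀
  have hB₀0 : 0 ≤ B₀ := by
    have : 0 ≤ ∑' n : ℕ, C n / (n : ℝ) ^ (5 / 2 : ℝ) := tsum_nonneg fun n ↦ by have := hC n; positivity
    positivity
  set B : ℝ := B₀ + 1 with hBdef
  have hB : 0 < B := by linarith
  -- the three bounds in Rademacher's format
  have hright : ∀ z : ℂ, z.re = 3 / 2 → ‖g z‖ ≤ B * ‖(2 : ℂ) + z‖ ^ (3 : ℝ) := by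
    intro z hz
    have ez : z = 3 / 2 + z.im * I := by apply Complex.ext <;> simp [hz]
    have e2 : (-1 / 2 + (z.im : ℂ) * I) + 2 + 2 = 2 + z := by
      apply Complex.ext
      · simp [hz]; norm_num
      · simp
    have h := norm_g_right_le (V := V) (J := J) hC ha hCs hJeq z.im
    rw [← ez, e2] at h
    rw [show (3 : ℝ) = ((3 : ℕ) : ℝ) by norm_num, Real.rpow_natCast]
    refine h.trans ?_
    exact mul_le_mul_of_nonneg_right (by linarith) (by positivity)
  have hleft : ∀ z : ℂ, z.re = -1 / 2 → ‖g z‖ ≤ (B * (7 / 3) ^ 3) * ‖(2 : ℂ) + z‖ ^ (7 : ℝ) := by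
    intro z hz
    have ez : z = -1 / 2 + z.im * I := by apply Complex.ext <;> simp [hz]
    have hright' : ∀ t : ℝ,
        ‖((3 / 2 + t * I : ℂ) * ((3 / 2 + t * I) - 1) * J (3 / 2 + t * I) + V / 2) *
            (Complex.Gamma (3 / 2 + t * I))⁻¹ * (Complex.Gamma ((3 / 2 + t * I) + 1))⁻¹‖ ≤
          B * ‖(-1 / 2 + t * I : ℂ) + 2 + 2‖ ^ 3 := by
      intro t
      refine (norm_g_right_le (V := V) (J := J) hC ha hCs hJeq t).trans ?_
      exact mul_le_mul_of_nonneg_right (by linarith) (by positivity)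
    have h := norm_g_left_le (V := V) hJfe hB.le hright' z.im
    rw [← ez, show z + 2 = 2 + z by ring] at h
    rw [show (7 : ℝ) = ((7 : ℕ) : ℝ) by norm_num, Real.rpow_natCast]
    exact h
  obtain ⟨Cg, hCg⟩ := exists_norm_g_le_exp_sq (V := V) (J := J) hJbd
  have hgr : ∀ z : ℂ, (-1 / 2 : ℝ) < z.re → z.re < (3 / 2 : ℝ) → ‖g z‖ ≤ max Cg 0 * Real.exp (|z.im| ^ (2 : ℝ)) := by
    intro z h1 h2
    exact (hCg z h1 h2).trans (mul_le_mul_of_nonneg_right (le_max_left _ _) (Real.exp_pos _).le)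
  have hfd : DiffContOnCl ℂ g (Complex.re ⁻¹' Ioo (-1 / 2 : ℝ) (3 / 2)) :=
    (differentiable_g (V := V) hJ).diffContOnCl
  refine ⟨max (B * (7 / 3) ^ 3) B, by positivity, fun z hz1 hz2 ↦ ?_⟩
  have hPL := Literature.Analysis.Complex.rademacher_phragmenLindelof_of_finiteOrder
    (f := g) (a := -1 / 2) (b := 3 / 2) (Q := 2) (A := B * (7 / 3) ^ 3) (B := B) (α := 7) (β := 3)
    (C := max Cg 0) (c := 2) (by norm_num) (by norm_num) (by positivity) hB (by norm_num) hfd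
    (by norm_num) hgr hleft hright hz1 hz2
  -- simplify the interpolated bound
  have hQz : (1 : ℝ) ≤ ‖(2 : ℂ) + z‖ := by
    have := Complex.re_le_norm ((2 : ℂ) + z)
    rw [Complex.add_re] at this
    norm_num at this
    linarith
  have hP0 : 0 ≤ ‖(2 : ℂ) + z‖ := norm_nonneg _
  set P : ℝ := ‖(2 : ℂ) + z‖ with hP
  set Kmax : ℝ := max (B * (7 / 3) ^ 3) B with hK
  have hK0 : 0 < Kmax := lt_max_of_lt_right hB
  have hX : B * (7 / 3) ^ 3 * P ^ (7 : ℝ) ≤ Kmax * P ^ (7 : ℝ) :=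
    mul_le_mul_of_nonneg_right (le_max_left _ _) (by positivity)
  have hY : B * P ^ (3 : ℝ) ≤ Kmax * P ^ (7 : ℝ) :=
    mul_le_mul (le_max_right _ _) (Real.rpow_le_rpow_of_exponent_le hQz (by norm_num)) (by positivity) hK0.le
  have hθ0 : 0 ≤ (3 / 2 - z.re) / (3 / 2 - (-1 / 2)) := by apply div_nonneg <;> linarith
  have hθ1 : (3 / 2 - z.re) / (3 / 2 - (-1 / 2)) ≤ 1 := by rw [div_le_one (by norm_num)]; linarith
  have hθ : (z.re - (-1 / 2)) / (3 / 2 - (-1 / 2)) = 1 - (3 / 2 - z.re) / (3 / 2 - (-1 / 2)) := by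
    field_simp; ring
  rw [hθ] at hPL
  have hfin := hPL.trans (rpow_mul_rpow_le_of_le (by positivity) (by positivity) hX hY hθ0 hθ1)
  rw [show z + 2 = 2 + z by ring, ← Real.rpow_natCast _ 7]
  push_cast
  exact hfin

end G

/-! ### The continued Dirichlet series `𝒟(w) = g(w-1) aʷ π^{w-1} / ((w-1)(w-2) ζ(2w-2))` -/

section Continuation

variable {C : ℕ → ℝ} {a : ℝ} {V : ℂ} {J : ℂ → ℂ}

/-- **`𝒟(w) = D(w)` on `Re w > 2`** (from `g_eq_of_one_lt_re` at `s = w - 1`).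
[cite: Rankin1939, §4] -/
theorem continuation_eq_LSeries (ha : 0 < a)
    (hJeq : ∀ s : ℂ, 1 < s.re → J s = (π : ℂ) ^ (-s) * Complex.Gamma s * riemannZeta (2 * s) *
      (Complex.Gamma (s + 1) * (a : ℂ) ^ (-(s + 1)) * LSeries (fun n ↦ (C n : ℂ)) (s + 1)) +
        (1 / (2 * s) + 1 / (2 * (1 - s))) * V)
    {w : ℂ} (hw : 2 < w.re) :
    ((w - 1) * ((w - 1) - 1) * J (w - 1) + V / 2) * (Complex.Gamma (w - 1))⁻¹ *
        (Complex.Gamma ((w - 1) + 1))⁻¹ * (a : ℂ) ^ w * (π : ℂ) ^ (w - 1) /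
          ((w - 1) * (w - 2) * riemannZeta (2 * w - 2)) =
      LSeries (fun n ↦ (C n : ℂ)) w := by
  have h1 : 1 < (w - 1).re := by simp; linarith
  rw [g_eq_of_one_lt_re (V := V) hJeq h1, sub_add_cancel, show 2 * (w - 1) = 2 * w - 2 by ring]
  have hw1 : w - 1 ≠ 0 := fun h ↦ by have := congrArg Complex.re h; simp at this; linarith
  have hw2 : w - 2 ≠ 0 := fun h ↦ by have := congrArg Complex.re h; simp at this; linarith
  have hζ : riemannZeta (2 * w - 2) ≠ 0 := riemannZeta_ne_zero_of_one_lt_re (by simp; linarith)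
  have hπ0 : (π : ℂ) ≠ 0 := by exact_mod_cast Real.pi_pos.ne'
  have ha0 : (a : ℂ) ≠ 0 := by exact_mod_cast ha.ne'
  have hπw : (π : ℂ) ^ (w - 1) ≠ 0 := by rw [Ne, cpow_eq_zero_iff, not_and_or]; exact Or.inl hπ0
  have haw : (a : ℂ) ^ w ≠ 0 := by rw [Ne, cpow_eq_zero_iff, not_and_or]; exact Or.inl ha0
  rw [Complex.cpow_neg, Complex.cpow_neg, show (w - 1 - 1) = w - 2 by ring]
  field_simp
  rw [show (w - 1) * 2 = 2 * w - 2 by ring, mul_div_assoc, mul_div_cancel₀ _ hζ]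

/-- **`𝒟` is holomorphic on `{Re w > 3/2} ∖ {2}`** (`g` entire; `ζ(2w-2) ≠ 0` and `≠ ∞` for
`Re w > 3/2`; `w - 1 ≠ 0`). [folklore] -/
theorem differentiableOn_continuation (ha : 0 < a) (hJ : Differentiable ℂ J) :
    DifferentiableOn ℂ (fun w : ℂ ↦ ((w - 1) * ((w - 1) - 1) * J (w - 1) + V / 2) *
        (Complex.Gamma (w - 1))⁻¹ * (Complex.Gamma ((w - 1) + 1))⁻¹ * (a : ℂ) ^ w * (π : ℂ) ^ (w - 1) /
          ((w - 1) * (w - 2) * riemannZeta (2 * w - 2)))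
      {w : ℂ | 3 / 2 < w.re ∧ w ≠ 2} := by
  intro w hw
  obtain ⟨hw1, hw2⟩ := hw
  have hπ0 : (π : ℂ) ≠ 0 := by exact_mod_cast Real.pi_pos.ne'
  have ha0 : (a : ℂ) ≠ 0 := by exact_mod_cast ha.ne'
  have hg := ((differentiable_g (V := V) hJ).comp (differentiable_id.sub_const 1)).differentiableAt (x := w)
  have hnum : DifferentiableAt ℂ (fun w : ℂ ↦ ((w - 1) * ((w - 1) - 1) * J (w - 1) + V / 2) *
      (Complex.Gamma (w - 1))⁻¹ * (Complex.Gamma ((w - 1) + 1))⁻¹ * (a : ℂ) ^ w * (π : ℂ) ^ (w - 1)) w := by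
    refine DifferentiableAt.mul (DifferentiableAt.mul ?_ ?_) ?_
    · exact hg
    · exact differentiableAt_id.const_cpow (Or.inl ha0)
    · exact (differentiableAt_id.sub_const 1).const_cpow (Or.inl hπ0)
  have hden : DifferentiableAt ℂ (fun w : ℂ ↦ (w - 1) * (w - 2) * riemannZeta (2 * w - 2)) w := by
    refine ((differentiableAt_id.sub_const 1).mul (differentiableAt_id.sub_const 2)).mul ?_
    have h2 : 2 * w - 2 ≠ 1 := fun h ↦ by have := congrArg Complex.re h; simp at this; linarith
    exact (differentiableAt_riemannZeta h2).comp w (((differentiableAt_id.const_mul 2).sub_const 2))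
  have hne : (w - 1) * (w - 2) * riemannZeta (2 * w - 2) ≠ 0 := by
    refine mul_ne_zero (mul_ne_zero ?_ (sub_ne_zero.mpr hw2)) (riemannZeta_ne_zero_of_one_lt_re (by simp; linarith))
    exact fun h ↦ by have := congrArg Complex.re h; simp at this; linarith
  exact (hnum.div hden hne).differentiableWithinAt

/-- **Polynomial growth in the strip**: if `‖g(z)‖ ≤ K ‖z+2‖⁷` on `-1/2 ≤ Re z ≤ 3/2`, then for
`3/2 + ε ≤ Re w ≤ 5/2` (`0 < ε`) and `|Im w| ≥ 1`,
`‖𝒟(w)‖ ≤ 4 K (7/2)⁷ (a^{3/2} + a^{5/2}) π^{3/2} Z_ε (1 + |Im w|)⁵`, `Z_ε = Σ n^{-(1+2ε)}`.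
[cite: Rankin1939, §4] -/
theorem norm_continuation_le (ha : 0 < a) {K : ℝ} (hK : 0 ≤ K)
    (hg : ∀ z : ℂ, -1 / 2 ≤ z.re → z.re ≤ 3 / 2 →
      ‖(z * (z - 1) * J z + V / 2) * (Complex.Gamma z)⁻¹ * (Complex.Gamma (z + 1))⁻¹‖ ≤ K * ‖z + 2‖ ^ 7)
    {ε : ℝ} (hε : 0 < ε) {w : ℂ} (hw1 : 3 / 2 + ε ≤ w.re) (hw2 : w.re ≤ 5 / 2) (hwi : 1 ≤ |w.im|) :
    ‖((w - 1) * ((w - 1) - 1) * J (w - 1) + V / 2) * (Complex.Gamma (w - 1))⁻¹ *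
        (Complex.Gamma ((w - 1) + 1))⁻¹ * (a : ℂ) ^ w * (π : ℂ) ^ (w - 1) /
          ((w - 1) * (w - 2) * riemannZeta (2 * w - 2))‖ ≤
      (4 * K * (7 / 2) ^ 7 * (a ^ (3 / 2 : ℝ) + a ^ (5 / 2 : ℝ)) * π ^ (3 / 2 : ℝ) *
          ∑' n : ℕ, (n : ℝ) ^ (-(1 + 2 * ε))) * (1 + |w.im|) ^ 5 := by
  set t := w.im with ht
  have hgw : ‖((w - 1) * ((w - 1) - 1) * J (w - 1) + V / 2) * (Complex.Gamma (w - 1))⁻¹ *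
      (Complex.Gamma ((w - 1) + 1))⁻¹‖ ≤ K * ‖w + 1‖ ^ 7 := by
    have h := hg (w - 1) (by simp; linarith) (by simp; linarith)
    rwa [show w - 1 + 2 = w + 1 by ring] at h
  have hw1n : ‖w + 1‖ ≤ 7 / 2 * (1 + |t|) := by
    calc ‖w + 1‖ ≤ |(w + 1).re| + |(w + 1).im| := Complex.norm_le_abs_re_add_abs_im _
      _ ≤ 7 / 2 * (1 + |t|) := by
          rw [Complex.add_re, Complex.one_re, Complex.add_im, Complex.one_im, add_zero, ← ht,
            abs_of_pos (by linarith : 0 < w.re + 1)]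
          have := abs_nonneg t
          nlinarith
  have haw : ‖(a : ℂ) ^ w‖ ≤ a ^ (3 / 2 : ℝ) + a ^ (5 / 2 : ℝ) := by
    rw [Complex.norm_cpow_eq_rpow_re_of_pos ha]
    rcases le_or_gt 1 a with h1 | h1
    · exact le_add_of_nonneg_of_le (by positivity) (Real.rpow_le_rpow_of_exponent_le h1 hw2)
    · exact le_add_of_le_of_nonneg (Real.rpow_le_rpow_of_exponent_ge ha h1.le (by linarith)) (by positivity)
  have hπw : ‖(π : ℂ) ^ (w - 1)‖ ≤ π ^ (3 / 2 : ℝ) := by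
    rw [Complex.norm_cpow_eq_rpow_re_of_pos Real.pi_pos, Complex.sub_re, Complex.one_re]
    exact Real.rpow_le_rpow_of_exponent_le (by linarith [Real.pi_gt_three]) (by linarith)
  have hden : (1 + |t|) ^ 2 / 4 ≤ ‖(w - 1) * (w - 2)‖ := by
    rw [norm_mul]
    have h1 : |t| ≤ ‖w - 1‖ := by
      have := Complex.abs_im_le_norm (w - 1); rwa [Complex.sub_im, Complex.one_im, sub_zero] at this
    have h2 : |t| ≤ ‖w - 2‖ := by
      have := Complex.abs_im_le_norm (w - 2)
      rwa [Complex.sub_im, show (2 : ℂ).im = 0 by simp, sub_zero] at this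
    have h12 : (1 + |t|) / 2 ≤ |t| := by linarith
    have h0 : 0 ≤ (1 + |t|) / 2 := by positivity
    calc (1 + |t|) ^ 2 / 4 = ((1 + |t|) / 2) * ((1 + |t|) / 2) := by ring
      _ ≤ ‖w - 1‖ * ‖w - 2‖ := mul_le_mul (h12.trans h1) (h12.trans h2) h0 (norm_nonneg _)
  have hζ : ‖(riemannZeta (2 * w - 2))⁻¹‖ ≤ ∑' n : ℕ, (n : ℝ) ^ (-(1 + 2 * ε)) :=
    norm_inv_riemannZeta_le (σ₀ := 1 + 2 * ε) (by linarith) (by simp; linarith)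
  have hZ0 : 0 ≤ ∑' n : ℕ, (n : ℝ) ^ (-(1 + 2 * ε)) := tsum_nonneg fun n ↦ Real.rpow_nonneg (Nat.cast_nonneg n) _
  have hden0 : 0 < ‖(w - 1) * (w - 2)‖ := lt_of_lt_of_le (by positivity) hden
  -- assemble
  rw [norm_inv] at hζ
  rw [norm_div, norm_mul ((w - 1) * (w - 2)), norm_mul, norm_mul, div_eq_mul_inv, mul_inv]
  have hinv : ‖(w - 1) * (w - 2)‖⁻¹ ≤ 4 / (1 + |t|) ^ 2 := by
    rw [inv_eq_one_div, div_le_div_iff₀ hden0 (by positivity)]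
    linarith
  calc ‖((w - 1) * ((w - 1) - 1) * J (w - 1) + V / 2) * (Complex.Gamma (w - 1))⁻¹ *
          (Complex.Gamma ((w - 1) + 1))⁻¹‖ * ‖(a : ℂ) ^ w‖ * ‖(π : ℂ) ^ (w - 1)‖ *
        (‖(w - 1) * (w - 2)‖⁻¹ * ‖riemannZeta (2 * w - 2)‖⁻¹)
      ≤ (K * ‖w + 1‖ ^ 7) * (a ^ (3 / 2 : ℝ) + a ^ (5 / 2 : ℝ)) * π ^ (3 / 2 : ℝ) *
          (4 / (1 + |t|) ^ 2 * ∑' n : ℕ, (n : ℝ) ^ (-(1 + 2 * ε))) := by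
        gcongr
    _ ≤ (K * (7 / 2 * (1 + |t|)) ^ 7) * (a ^ (3 / 2 : ℝ) + a ^ (5 / 2 : ℝ)) * π ^ (3 / 2 : ℝ) *
          (4 / (1 + |t|) ^ 2 * ∑' n : ℕ, (n : ℝ) ^ (-(1 + 2 * ε))) := by
        gcongr
    _ = (4 * K * (7 / 2) ^ 7 * (a ^ (3 / 2 : ℝ) + a ^ (5 / 2 : ℝ)) * π ^ (3 / 2 : ℝ) *
          ∑' n : ℕ, (n : ℝ) ^ (-(1 + 2 * ε))) * (1 + |t|) ^ 5 := by
        have h0 : (1 + |t|) ≠ 0 := by positivity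
        field_simp

/-- **The simple pole at `w = 2`**: `𝒟(w) = φ(w)/(w - 2)` with
`φ(w) = g(w-1) aʷ π^{w-1} / ((w-1) ζ(2w-2))` (an identity of meromorphic expressions). [folklore] -/
theorem continuation_eq_div (w : ℂ) :
    ((w - 1) * ((w - 1) - 1) * J (w - 1) + V / 2) * (Complex.Gamma (w - 1))⁻¹ *
        (Complex.Gamma ((w - 1) + 1))⁻¹ * (a : ℂ) ^ w * (π : ℂ) ^ (w - 1) /
          ((w - 1) * (w - 2) * riemannZeta (2 * w - 2)) =
      (((w - 1) * ((w - 1) - 1) * J (w - 1) + V / 2) * (Complex.Gamma (w - 1))⁻¹ *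
        (Complex.Gamma ((w - 1) + 1))⁻¹ * (a : ℂ) ^ w * (π : ℂ) ^ (w - 1) /
          ((w - 1) * riemannZeta (2 * w - 2))) / (w - 2) := by
  rw [div_div]
  ring

/-- `φ` is holomorphic on `{Re w > 3/2}` (in particular at `w = 2`). [folklore] -/
theorem differentiableAt_phi (ha : 0 < a) (hJ : Differentiable ℂ J) {w : ℂ} (hw : 3 / 2 < w.re) :
    DifferentiableAt ℂ (fun w : ℂ ↦ ((w - 1) * ((w - 1) - 1) * J (w - 1) + V / 2) *
        (Complex.Gamma (w - 1))⁻¹ * (Complex.Gamma ((w - 1) + 1))⁻¹ * (a : ℂ) ^ w * (π : ℂ) ^ (w - 1) /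
          ((w - 1) * riemannZeta (2 * w - 2))) w := by
  have hπ0 : (π : ℂ) ≠ 0 := by exact_mod_cast Real.pi_pos.ne'
  have ha0 : (a : ℂ) ≠ 0 := by exact_mod_cast ha.ne'
  have hg := ((differentiable_g (V := V) hJ).comp (differentiable_id.sub_const 1)).differentiableAt (x := w)
  have hnum : DifferentiableAt ℂ (fun w : ℂ ↦ ((w - 1) * ((w - 1) - 1) * J (w - 1) + V / 2) *
      (Complex.Gamma (w - 1))⁻¹ * (Complex.Gamma ((w - 1) + 1))⁻¹ * (a : ℂ) ^ w * (π : ℂ) ^ (w - 1)) w := by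
    refine DifferentiableAt.mul (DifferentiableAt.mul ?_ ?_) ?_
    · exact hg
    · exact differentiableAt_id.const_cpow (Or.inl ha0)
    · exact (differentiableAt_id.sub_const 1).const_cpow (Or.inl hπ0)
  have hden : DifferentiableAt ℂ (fun w : ℂ ↦ (w - 1) * riemannZeta (2 * w - 2)) w := by
    refine (differentiableAt_id.sub_const 1).mul ?_
    have h2 : 2 * w - 2 ≠ 1 := fun h ↦ by have := congrArg Complex.re h; simp at this; linarith
    exact (differentiableAt_riemannZeta h2).comp w (((differentiableAt_id.const_mul 2).sub_const 2))
  have hne : (w - 1) * riemannZeta (2 * w - 2) ≠ 0 := by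
    refine mul_ne_zero ?_ (riemannZeta_ne_zero_of_one_lt_re (by simp; linarith))
    exact fun h ↦ by have := congrArg Complex.re h; simp at this; linarith
  exact hnum.div hden hne

/-- **The residue at `w = 2` is `3a²V/π`**: `φ(2) = g(1) a² π / ζ(2)` with `g(1) = V/2`
(`Γ(1) = Γ(2) = 1`) and `ζ(2) = π²/6`. [cite: Rankin1939, §4] -/
theorem continuation_residue (a : ℝ) (V : ℂ) (J : ℂ → ℂ) :
    (((2 : ℂ) - 1) * (((2 : ℂ) - 1) - 1) * J ((2 : ℂ) - 1) + V / 2) * (Complex.Gamma ((2 : ℂ) - 1))⁻¹ *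
        (Complex.Gamma (((2 : ℂ) - 1) + 1))⁻¹ * (a : ℂ) ^ (2 : ℂ) * (π : ℂ) ^ ((2 : ℂ) - 1) /
          (((2 : ℂ) - 1) * riemannZeta (2 * 2 - 2)) = 3 * (a : ℂ) ^ 2 * V / π := by
  have hπ0 : (π : ℂ) ≠ 0 := by exact_mod_cast Real.pi_pos.ne'
  have hΓ2 : Complex.Gamma (((2 : ℂ) - 1) + 1) = 1 := by
    rw [show ((2 : ℂ) - 1) + 1 = 1 + 1 by ring, Complex.Gamma_add_one 1 one_ne_zero, Complex.Gamma_one, mul_one]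
  rw [show (2 : ℂ) - 1 = 1 by ring] at hΓ2 ⊢
  rw [hΓ2, Complex.Gamma_one, show (2 : ℂ) * 2 - 2 = 2 by ring, riemannZeta_two, Complex.cpow_one,
    Complex.cpow_two]
  field_simp
  ring

end Continuation

end Literature.NumberTheory.Automorphic

end
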